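import Summits.Ventures.PercRepro.StarGadgetFPrimeS0A
import Summits.Ventures.PercRepro.StarGadgetFPrimeS0B
import Summits.Ventures.PercRepro.StarGadgetFPrimeSposA
import Summits.Ventures.PercRepro.StarGadgetFPrimeSposB

/-!
# F′ ≥ 0 on ℕ⁴: the half-space lemmas, the finite boxes and the tight ray

The uncovered points (q, r ≤ 4 and p ≤ 6 at s = 0; p ≤ 4, q, r ≤ 1, s = 1) are evaluated by `interval_cases` + `norm_num`; the ray (p, 0, 0, 0) is `F'_ray`.
-/

namespace PercRepro.StarGadget

/-- **`F' ≥ 0` on `ℕ⁴`**: the (★)-slack of every star gadget without the edge `cx` is nonnegative. -/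
theorem F'_nonneg (p q r s : ℕ) : 0 ≤ F' p q r s := by
  rcases s with _ | s
  · by_cases hq : 5 ≤ q
    · obtain ⟨q, rfl⟩ := Nat.exists_eq_add_of_le' hq
      exact F'_s0_q_000 p q r
    by_cases hr : 5 ≤ r
    · obtain ⟨r, rfl⟩ := Nat.exists_eq_add_of_le' hr
      exact F'_s0_r_000 p q r
    by_cases hpq : 7 ≤ p ∧ 1 ≤ q
    · obtain ⟨p, rfl⟩ := Nat.exists_eq_add_of_le' hpq.1
      obtain ⟨q, rfl⟩ := Nat.exists_eq_add_of_le' hpq.2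
      exact F'_s0_p_010 p q r
    by_cases hpr : 7 ≤ p ∧ 1 ≤ r
    · obtain ⟨p, rfl⟩ := Nat.exists_eq_add_of_le' hpr.1
      obtain ⟨r, rfl⟩ := Nat.exists_eq_add_of_le' hpr.2
      exact F'_s0_p_001 p q r
    push Not at hq hr hpq hpr
    by_cases hp : 7 ≤ p
    · have hq0 : q = 0 := by have := hpq hp; omega
      have hr0 : r = 0 := by have := hpr hp; omega
      subst hq0 hr0
      rw [F'_ray]
    · push Not at hp
      interval_cases p <;> interval_cases q <;> interval_cases r <;> norm_num [F']
  · by_cases hp : 5 ≤ p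
    · obtain ⟨p, rfl⟩ := Nat.exists_eq_add_of_le' hp
      exact F'_spos_p_0001 p q r s
    by_cases hq : 2 ≤ q
    · obtain ⟨q, rfl⟩ := Nat.exists_eq_add_of_le' hq
      exact F'_spos_q_0001 p q r s
    by_cases hr : 2 ≤ r
    · obtain ⟨r, rfl⟩ := Nat.exists_eq_add_of_le' hr
      exact F'_spos_r_0001 p q r s
    by_cases hs : 1 ≤ s
    · obtain ⟨s, rfl⟩ := Nat.exists_eq_add_of_le' hs
      exact F'_spos_s_0001 p q r s
    push Not at hp hq hr hs
    interval_cases p <;> interval_cases q <;> interval_cases r <;> interval_cases s <;> norm_num [F']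

end PercRepro.StarGadget
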